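import Summits.AtomisticToContinuum.HydrodynamicLimit.Theorems.LambertianContactSwapLambertianEulerWindowRestart
import Summits.AtomisticToContinuum.HydrodynamicLimit.Theorems.LambertianContactSwapLambertianEulerRestartEntropyInequality
import HarnessLib

/-!
# The window entropy inequality with restart for the Lambertian gas (step ENT of the entropy route to the hearts P3Λ/P4Λ; line `Sketch`, crux stmt-11854)

Support file (`--supports stmt-AtomisticToContinuum-11854`).  The two halves landed by lead c6 — the restart of bounded window
functionals (`…WindowRestart.integral_window_restart`, p135943) and the entropy inequality across the shared noise factor
(`…RestartEntropyInequality.integral_prod_noise_ge`, p135760) — assembled into the single statement a prover of the hearts consumes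
(`window_entropyInequality_restart`): for `0 < σ < 1/2`, a probability law `P ≪ liouville` (the local Gibbs data `λ_N`), ANY
probability reference `R` on configurations (the local Gibbs reference `ψ_s`), a bounded jointly measurable time-dependent observable
`G` (a CLAMPED current), `s, h ≥ 0` and a rate `β > 0`, with `μ_s` the law of `Λ_s` under `P ⊗ γ^ℕ` and `KL(μ_s ‖ R) < ∞`:
`−E_{P⊗γ^ℕ}[∫_s^{s+h} G(r, Λ_r) dr] ≤ β⁻¹ (KL(μ_s ‖ R) + log E_{R⊗γ^ℕ}[exp(−β ∫_0^h G(s+r, Λ_r) dr)])`.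
With `β = γ₀/h` the entropy is paid in the hearts' currency `(h/γ₀)·H_N(s)`; what remains for P3Λ/P4Λ is the exponential moment, at the
fixed rate `γ₀`, of the window time-average of the clamped current along `Λ` started from `R = ψ_s` with fresh noise (KCW-Λ / CCW-Λ,
research; `Cruxes/LambertianEuler/Lines/Sketch.md` §c6.3).  Lead prover-line-stmt-AtomisticToContinuum-11854-c6-0, 2026-08-17.
-/

noncomputable section

namespace Summit.AtomisticToContinuum.HydrodynamicLimit.Theorems.LambertianContactSwapLambertianEulerWindowEntropyInequality

open scoped BigOperators Topology ENNReal
open MeasureTheory ProbabilityTheory Filter Set InformationTheory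
open Literature.MathematicalPhysics.KineticTheory
open Literature.Analysis.FluidPDE Literature.Analysis.FluidPDE.Alexander
open Summit.AtomisticToContinuum.HydrodynamicLimit.Theorems.LambertianContactSwapLambertianEulerWindowRestart
open Summit.AtomisticToContinuum.HydrodynamicLimit.Theorems.LambertianContactSwapLambertianEulerRestartEntropyInequality

/-- **The window entropy inequality with restart** (registered sub-goal `window_entropyInequality_restart` of stmt-11854):
`−E_{P⊗γ^ℕ}[∫_s^{s+h} G(r, Λ_r) dr] ≤ β⁻¹ (KL(μ_s ‖ R) + log ∫ exp(−β ∫_0^h G(s+r, Λ_r(q)) dr) d(R⊗γ^ℕ)(q))`, `μ_s = (P⊗γ^ℕ)∘Λ_s⁻¹`,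
for bounded jointly measurable `G`, `P ≪ liouville` and `R` probability laws, `KL(μ_s ‖ R) < ∞`, `s, h ≥ 0`, `β > 0`.
Proof: `integral_window_restart` (p135943) then `integral_prod_noise_ge` (p135760) at `μ = μ_s`; the window functional
`q ↦ ∫_0^h G(s+r, Λ_r q) dr` is measurable (`StronglyMeasurable.integral_prod_right'` on the jointly measurable integrand, p128074) and
bounded by `B h`, so it and `exp(−β ·)` of it are integrable on the probability spaces. [cite: KipnisLandim1999, Appendix 1 §8] -/
theorem window_entropyInequality_restart : ∀ {σ : ℝ}, 0 < σ → σ < 2⁻¹ → ∀ (N : ℕ)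
    (P R : Measure (Config (N + 1) (Fin 3) T3)) [IsProbabilityMeasure P] [IsProbabilityMeasure R],
    P ≪ liouville (Torus.geometry (Fin 3)) (N + 1) (hsDiameter σ N) →
    ∀ (G : ℝ × Config (N + 1) (Fin 3) T3 → ℝ), Measurable G → ∀ B : ℝ, (∀ x, |G x| ≤ B) →
    ∀ (s h β : ℝ), 0 ≤ s → 0 ≤ h → 0 < β →
    klDiv (((P.prod (lambertNoise (Fin 3))).map
        (fun p => lambertFlow (Torus.geometry (Fin 3)) (hsDiameter σ N) p.2 p.1 s))) R ≠ ⊤ →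
    -(∫ p, (∫ r in s..(s + h), G (r, lambertFlow (Torus.geometry (Fin 3)) (hsDiameter σ N) p.2 p.1 r))
        ∂((P.prod (lambertNoise (Fin 3))))) ≤
      β⁻¹ * ((klDiv (((P.prod (lambertNoise (Fin 3))).map
          (fun p => lambertFlow (Torus.geometry (Fin 3)) (hsDiameter σ N) p.2 p.1 s))) R).toReal +
        Real.log (∫ q, Real.exp (-(β * ∫ r in (0 : ℝ)..h,
            G (s + r, lambertFlow (Torus.geometry (Fin 3)) (hsDiameter σ N) q.2 q.1 r)))
          ∂(R.prod (lambertNoise (Fin 3))))) := by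
  intro σ hσ hσ' N P R _ _ hP G hG B hB s h β hs hh hβ hfin
  rw [integral_window_restart hσ hσ' N P hP G hG B hB s h hs hh]
  -- the restarted law and the window functional
  have hmeasΛ : ∀ t : ℝ, Measurable fun p : Config (N + 1) (Fin 3) T3 × (ℕ → V3) =>
      lambertFlow (Torus.geometry (Fin 3)) (hsDiameter σ N) p.2 p.1 t :=
    fun t => measurable_lambertFlow_hsDiameter hσ.le hσ' N t
  haveI : IsProbabilityMeasure (((P.prod (lambertNoise (Fin 3))).map
      (fun p => lambertFlow (Torus.geometry (Fin 3)) (hsDiameter σ N) p.2 p.1 s))) :=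
    Measure.isProbabilityMeasure_map (hmeasΛ s).aemeasurable
  have hΛu := LambertianContactSwapLambertianEulerJointMeasurable.measurable_lambertFlow_uncurry_torus hσ.le hσ' N
  -- joint measurability of the integrand and strong measurability of the window functional
  have hm : Measurable fun q : (Config (N + 1) (Fin 3) T3 × (ℕ → V3)) × ℝ =>
      G (s + q.2, lambertFlow (Torus.geometry (Fin 3)) (hsDiameter σ N) q.1.2 q.1.1 q.2) :=
    hG.comp ((measurable_const.add measurable_snd).prodMk hΛu)
  have hFsm : StronglyMeasurable fun q : Config (N + 1) (Fin 3) T3 × (ℕ → V3) =>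
      ∫ r in (0 : ℝ)..h, G (s + r, lambertFlow (Torus.geometry (Fin 3)) (hsDiameter σ N) q.2 q.1 r) := by
    simp only [intervalIntegral.integral_of_le hh]
    exact hm.stronglyMeasurable.integral_prod_right' (ν := volume.restrict (Ioc 0 h))
  -- the window functional is bounded by `B h`
  have hFbd : ∀ q : Config (N + 1) (Fin 3) T3 × (ℕ → V3),
      ‖∫ r in (0 : ℝ)..h, G (s + r, lambertFlow (Torus.geometry (Fin 3)) (hsDiameter σ N) q.2 q.1 r)‖ ≤ B * h := by
    intro q
    have h1 := intervalIntegral.norm_integral_le_of_norm_le_const (a := (0 : ℝ)) (b := h) (C := B)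
      (f := fun r => G (s + r, lambertFlow (Torus.geometry (Fin 3)) (hsDiameter σ N) q.2 q.1 r))
      (fun r _ => by rw [Real.norm_eq_abs]; exact hB _)
    simpa only [sub_zero, abs_of_nonneg hh] using h1
  have hF : Integrable (fun q : Config (N + 1) (Fin 3) T3 × (ℕ → V3) =>
      ∫ r in (0 : ℝ)..h, G (s + r, lambertFlow (Torus.geometry (Fin 3)) (hsDiameter σ N) q.2 q.1 r))
      ((((P.prod (lambertNoise (Fin 3))).map
        (fun p => lambertFlow (Torus.geometry (Fin 3)) (hsDiameter σ N) p.2 p.1 s))).prod (lambertNoise (Fin 3))) :=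
    (integrable_const (B * h)).mono' hFsm.aestronglyMeasurable (ae_of_all _ hFbd)
  have hexp : Integrable (fun q : Config (N + 1) (Fin 3) T3 × (ℕ → V3) =>
      Real.exp (-(β * ∫ r in (0 : ℝ)..h, G (s + r, lambertFlow (Torus.geometry (Fin 3)) (hsDiameter σ N) q.2 q.1 r))))
      (R.prod (lambertNoise (Fin 3))) := by
    refine (integrable_const (Real.exp (β * (B * h)))).mono'
      (Real.measurable_exp.comp_aemeasurable ((hFsm.measurable.const_mul β).neg.aemeasurable)).aestronglyMeasurable
      (ae_of_all _ fun q => ?_)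
    rw [Real.norm_eq_abs, abs_of_pos (Real.exp_pos _), Real.exp_le_exp]
    have h1 := hFbd q
    rw [Real.norm_eq_abs] at h1
    have h2 := (abs_le.1 h1).1
    nlinarith [hβ, h2]
  exact integral_prod_noise_ge _ R (lambertNoise (Fin 3)) hfin hβ hF hexp

end Summit.AtomisticToContinuum.HydrodynamicLimit.Theorems.LambertianContactSwapLambertianEulerWindowEntropyInequality
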